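import Summits.BirchSwinnertonDyer.Rank1Residual.Additive.InertialTorsionAdditive
import Literature.NumberTheory.EllipticCurves.FormalGroupKummerPointProofs
import Literature.NumberTheory.EllipticCurves.OrdinaryLocalReductionMapProofs
import Summits.BirchSwinnertonDyer.Rank1Residual.X2.GreenbergVatsalReductionDatum
import HarnessLib

/-!
# `Γ_{ℚ_v}`-fixed points of `E(K̄_v)` at an ADDITIVE place `v ∋ p`: a bounded multiple lands in
# `E₁` of the minimal model, fixed torsion has bounded exponent, points `p`-divisible modulo torsion
# by fixed points for every `n` are torsion, and a fixed point of infinite order exists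
# (row T-T3B FILE F4, part 1a = the level-calculus engine: set-up and `E₂` lemmas; cell `b2b-bsdres`, team n1011, seat p07
# (gen 9) for p12 GEN 8's row T-T3B; p12's frozen F4 signatures, cells/n1011/INBOX.md 19:50Z)

HONEST FRAMING (cell `b2b-bsdres`, run/shared/lean/b2b/bsd-rank1-residual/, verbatim in every
file): the goal of the cell is to DELETE the COMBINATION-SHAPED residual classes of the
Birch–Swinnerton-Dyer formula for ALL analytic-rank `≤ 1` elliptic curves over `ℚ` — "full BSD
formula for every rank `≤ 1` curve in class `C`" assembled STRICTLY from published theorems — so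
that the rank-`≤ 1` remainder becomes exactly the CONSTRUCTION-SHAPED classes, which are TYPED
(missing-input `Prop`s), NOT attempted. This is not "finishing BSD". Team n1011 (N10/N11): research
route on the CONSTRUCTION-SHAPED classes X3♯/X4♯(G-ord); TOOL theorems only: NO definition, NO
named fact; closes nothing; census −0; nothing booked.

## What (row T-T3B = r2's T3b = p06's T-T3CTL F3 `𝒦_{v,0}[p^∞] = ⊥` at `v = p`; owner p12)

p12's F4 needs, for the `Γ_{ℚ_v}`-FIXED points of `E(K̄_v)`, finiteness of the fixed `p`-power
torsion (F4.d) and a fixed kernel point outside `p·(fixed kernel points) + (fixed torsion)` (F4.e).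
Both follow from the LEVEL CALCULUS on the minimal model `X` of `E` at `v` (Silverman VII.2.2 /
IV.3.2 / IV.6.4; tree `FormalGroupChart.val_zCoord_nsmul[_eq]`) with Kodaira–Néron at an ADDITIVE
place (tree `exists_nsmul_reducesToNonsingular_le_four_of_hasAdditiveReduction`: ONE `c ≤ 4` with
`c·P ∈ E₀(X)` for every inertia-fixed `P`) and the cusp `E₀(X) → k̄⁺` (tree
`exists_addMonoidHom_residueField_of_cusp`, kernel `E₁`) whose target is killed by `p` as `v ∋ p`:
so `p·c·P ∈ E₁(X)` for every fixed `P` (`exists_transport_nsmul_mem_kernel`). `Φ`-free exports: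

* `exists_nsmul_eq_zero_of_fixed_of_isOfFinAddOrder` — ONE `N > 0` kills every fixed TORSION point
  (`N = p²c`: `pcR ∈ E₁` is fixed so `|z(pcR)| ≤ |p|`; `p²cR ∈ E₂ = {|z| < |p|}`, torsion-free by
  `|z(mQ)| = |m|·|z(Q)|`);
* `isOfFinAddOrder_of_forall_exists_fixed` — `R ∈ pⁿ·(fixed) + (fixed torsion)` for EVERY `n`
  forces `R` torsion (`|z(Φ(K·R))| ≤ |p|ⁿ` for all `n`, `|p| < 1`);
* `exists_fixed_not_isOfFinAddOrder` — a fixed point of INFINITE order (Hensel's point of `E₁(X)`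
  with `z = p²`, tree `exists_mem_kernel_zCoord_eq`).

Hypotheses: `v ∋ p`, `W.HasAdditiveReductionAt v`; NO `p ≥ 5`, NO ordinarity, NO good model.

References: J. H. Silverman, *AEC* 2nd ed. VII.2.1, VII.2.2, VII.6.1, IV.3.2, IV.6.4
[SilvermanAEC2009]; R. Greenberg, LNM 1716 (1999) §3 Lemma 3.4 [GreenbergLNM1716];
cells/n1011/skel/T-T3B.md (p12 GEN 8).
-/

set_option autoImplicit false

noncomputable section

open scoped Classical NNReal

open NumberField IsDedekindDomain Field IsDedekindDomain.HeightOneSpectrum WeierstrassCurve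
open Literature.NumberTheory.EllipticCurves Literature.NumberTheory.GaloisRepresentations
  Literature.NumberTheory.EllipticCurves.FormalGroupChart
  Summit.BirchSwinnertonDyer.Rank1Residual.X2.GreenbergVatsalReductionDatum

namespace Summit.BirchSwinnertonDyer.Rank1Residual.Additive.FixedLevel

variable (W : WeierstrassCurve ℚ) [W.IsElliptic] (p : ℕ) [hp : Fact p.Prime]
  {v : HeightOneSpectrum (𝓞 ℚ)}


/-- `0 < |p|_v < 1` for `v ∋ p`. [folklore] -/
theorem val_p_pos_lt_one (hpv : ((p : ℕ) : 𝓞 ℚ) ∈ v.asIdeal) :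
    0 < specVal v (p : (AlgebraicClosure (v.adicCompletion ℚ))) ∧ specVal v (p : (AlgebraicClosure
        (v.adicCompletion ℚ))) < 1 := by
  haveI : CharZero (AlgebraicClosure (v.adicCompletion ℚ)) := charZero_of_injective_algebraMap
      (algebraMap ℚ _).injective
  refine ⟨by rw [Valuation.pos_iff]; exact Nat.cast_ne_zero.mpr hp.out.ne_zero, ?_⟩
  have h := spectralValuation_algebraMap_ringOfIntegers_lt_one (v := v) (specVal_spec v) hpv
  rwa [map_natCast] at h

/-! ### §1 The engine: a bounded multiple of every fixed point lies in `E₁` of the minimal model -/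

/-- **Set-up (Kodaira–Néron + cusp at `v ∋ p`).** The minimal model `X` of `E` at an additive
`v ∋ p` (integral for `|·|_v` on `K̄_v`, elliptic), the `Γ_{ℚ_v}`-equivariant transport
`Φ : E(K̄_v) ≃ X(K̄_v)`, and ONE `N > 0` (`N = p·c`, `c ≤ 4` the Kodaira–Néron exponent) with
`N • Φ R ∈ E₁(X)` for every `Γ_{ℚ_v}`-fixed `R`: `c • Φ R ∈ E₀(X)` and the cuspidal reduction
`E₀(X) → k̄⁺` kills `p • (c • Φ R)` (`p = 0` in `k̄`). [cite: SilvermanAEC2009, Thm. VII.6.1, Prop. VII.2.1, VII.5.1(c)] -/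
theorem exists_transport_nsmul_mem_kernel (hpv : ((p : ℕ) : 𝓞 ℚ) ∈ v.asIdeal)
    (hadd : W.HasAdditiveReductionAt v) :
    ∃ (X : WeierstrassCurve (v.adicCompletion ℚ)) (hI : (X.baseChange (AlgebraicClosure
        (v.adicCompletion ℚ))).IsIntegral (specVal v).integer)
      (_ : (X.baseChange (AlgebraicClosure (v.adicCompletion ℚ))).IsElliptic)
      (Φ : localPoints W (v.adicCompletion ℚ) ≃+ (X.baseChange (AlgebraicClosure (v.adicCompletion
          ℚ))).toAffine.Point)
      (N : ℕ), 0 < N ∧ (∀ (σ : absoluteGaloisGroup (v.adicCompletion ℚ)) (Q : localPoints W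
          (v.adicCompletion ℚ)),
        Φ (σ • Q) = Affine.Point.map ((absoluteGaloisGroup.toAlgEquiv _ σ : (AlgebraicClosure
            (v.adicCompletion ℚ)) ≃ₐ[v.adicCompletion ℚ]
              (AlgebraicClosure (v.adicCompletion ℚ))) : (AlgebraicClosure (v.adicCompletion ℚ))
                  →ₐ[v.adicCompletion ℚ] (AlgebraicClosure (v.adicCompletion ℚ))) (Φ Q)) ∧ (∀ R :
                  localPoints W (v.adicCompletion ℚ),
        (∀ σ : absoluteGaloisGroup (v.adicCompletion ℚ), σ • R = R) →
          (haveI := hI; N • Φ R ∈ kernel (specVal v) (X.baseChange (AlgebraicClosure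
              (v.adicCompletion ℚ))))) := by
  have hw := specVal_spec v
  have hv0 : (specVal v).Integers (specVal v).integer := Valuation.integer.integers (specVal v)
  have hint : ((W.localMinimalModel v).baseChange (AlgebraicClosure (v.adicCompletion
      ℚ))).IsIntegral (specVal v).integer := by
    have := WeierstrassCurve.isIntegral_spectralValuation_baseChange hw
      ((W.localMinimalModel v).integralModel (v.adicCompletionIntegers ℚ))
    rwa [show ((W.localMinimalModel v).integralModel (v.adicCompletionIntegers ℚ)).map
        (algebraMap (v.adicCompletionIntegers ℚ) (v.adicCompletion ℚ)) = (W.localMinimalModel v)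
            from
      WeierstrassCurve.baseChange_integralModel_eq (v.adicCompletionIntegers ℚ)
          (W.localMinimalModel v)] at this
  haveI hXell : (W.localMinimalModel v).IsElliptic := W.isElliptic_localMinimalModel v
  haveI : ((W.localMinimalModel v).baseChange (AlgebraicClosure (v.adicCompletion ℚ))).IsElliptic
      := by infer_instance
  obtain ⟨M, hM⟩ := hint.integral
  obtain ⟨C, hC⟩ := W.exists_variableChange_smul_eq_localMinimalModel v
  obtain ⟨Φ, hΦ⟩ := W.exists_addEquiv_localPoints_of_smul_eq v hC
  obtain ⟨𝔐, h𝔐⟩ := v.localPrimesAbove_nonempty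
  haveI : (W.localMinimalModel v).HasAdditiveReduction (v.adicCompletionIntegers ℚ) := hadd
  obtain ⟨c, hc0, -, hcE₀⟩ :=
    (W.localMinimalModel v).exists_nsmul_reducesToNonsingular_le_four_of_hasAdditiveReduction
        (specVal v) hw h𝔐
  -- the cusp `E₀(M) → k̄⁺`
  have hcoef : ∀ {a : v.adicCompletionIntegers ℚ} (b : (specVal v).integer),
      algebraMap (specVal v).integer (AlgebraicClosure (v.adicCompletion ℚ)) b =
        algebraMap (v.adicCompletion ℚ) (AlgebraicClosure (v.adicCompletion ℚ)) (algebraMap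
            (v.adicCompletionIntegers ℚ) (v.adicCompletion ℚ) a) →
      IsDedekindDomain.HeightOneSpectrum.valuation (v.adicCompletion ℚ)
          (IsDiscreteValuationRing.maximalIdeal (v.adicCompletionIntegers ℚ))
          (algebraMap (v.adicCompletionIntegers ℚ) (v.adicCompletion ℚ) a) < 1 →
      IsLocalRing.residue (specVal v).integer b = 0 := by
    intro a b hab hlt
    have hmem : a ∈ IsLocalRing.maximalIdeal (v.adicCompletionIntegers ℚ) :=
      (IsDedekindDomain.HeightOneSpectrum.valuation_lt_one_iff_mem _ a).mp hlt
    rw [← v_algebraMap_lt_one_iff hv0, hab]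
    exact WeierstrassCurve.spectralValuation_algebraMap_lt_one_of_mem_maximalIdeal hw h𝔐 hmem
  have hΔ : IsLocalRing.residue (specVal v).integer M.Δ = 0 := by
    refine hcoef (a := ((W.localMinimalModel v).integralModel (v.adicCompletionIntegers ℚ)).Δ) M.Δ
        ?_ ?_
    · rw [WeierstrassCurve.integralModel_Δ_eq, ← WeierstrassCurve.map_Δ, ← WeierstrassCurve.map_Δ]
      exact congrArg WeierstrassCurve.Δ hM.symm
    · rw [WeierstrassCurve.integralModel_Δ_eq]; exact hadd.badReduction
  have hc₄ : IsLocalRing.residue (specVal v).integer M.c₄ = 0 := by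
    refine hcoef (a := ((W.localMinimalModel v).integralModel (v.adicCompletionIntegers ℚ)).c₄)
        M.c₄ ?_ ?_
    · rw [WeierstrassCurve.integralModel_c₄_eq, ← WeierstrassCurve.map_c₄, ←
        WeierstrassCurve.map_c₄]
      exact congrArg WeierstrassCurve.c₄ hM.symm
    · rw [WeierstrassCurve.integralModel_c₄_eq]; exact hadd.additiveReduction
  obtain ⟨rc, hrc⟩ := M.exists_addMonoidHom_residueField_of_cusp hv0 hΔ hc₄
  -- `p = 0` in `k̄`
  have hpk : ((p : ℕ) : AlgebraicClosure (IsLocalRing.ResidueField (specVal v).integer)) = 0 := by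
    have hpw : (specVal v) (algebraMap (specVal v).integer (AlgebraicClosure (v.adicCompletion ℚ))
        (p : (specVal v).integer)) < 1 := by
      rw [map_natCast]; exact (val_p_pos_lt_one p hpv).2
    have h1 : IsLocalRing.residue (specVal v).integer (p : (specVal v).integer) = 0 := by
      rw [IsLocalRing.residue_eq_zero_iff, IsLocalRing.mem_maximalIdeal, mem_nonunits_iff,
        hv0.isUnit_iff_valuation_eq_one]
      exact ne_of_lt hpw
    have := congrArg (algebraMap (IsLocalRing.ResidueField (specVal v).integer)
      (AlgebraicClosure (IsLocalRing.ResidueField (specVal v).integer))) h1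
    rwa [map_natCast, map_zero] at this
  refine ⟨(W.localMinimalModel v), hint, inferInstance, Φ, p * c, Nat.mul_pos hp.out.pos hc0, hΦ,
      fun R hR ↦ ?_⟩
  -- `c • Φ R ∈ E₀(M)`
  have hRfix : ∀ σ ∈ 𝔐.inertia (absoluteGaloisGroup (v.adicCompletion ℚ)),
      Affine.Point.map ((absoluteGaloisGroup.toAlgEquiv _ σ : (AlgebraicClosure (v.adicCompletion
          ℚ)) ≃ₐ[v.adicCompletion ℚ] (AlgebraicClosure (v.adicCompletion ℚ))) :
          (AlgebraicClosure (v.adicCompletion ℚ)) →ₐ[v.adicCompletion ℚ] (AlgebraicClosure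
              (v.adicCompletion ℚ))) (Φ R) = Φ R := by
    intro σ _
    rw [← hΦ σ R, hR σ]
  have hE₀ : M.HasNonsingularReduction (Affine.Point.congrEquiv hM (c • Φ R)) :=
    (reducesToNonsingular_iff_hasNonsingularReduction M _).mp
      ((reducesToNonsingular_congrEquiv_iff _ _ hM _).mpr (hcE₀ _ hRfix))
  set y : M.nonsingularReductionSubgroup hv0 := ⟨Affine.Point.congrEquiv hM (c • Φ R), hE₀⟩ with hy
  -- `rc (p • y) = 0`, so `p • y` reduces to `O`, i.e. lies in `E₁`
  have hry : rc (p • y) = 0 := by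
    rw [map_nsmul, nsmul_eq_mul, hpk, zero_mul]
  have hred0 : M.ReducesToZero ((p • y : M.nonsingularReductionSubgroup hv0) :
      (M.baseChange (AlgebraicClosure (v.adicCompletion ℚ))).toAffine.Point) :=
    (hrc _).mp hry
  haveI hIM : (M.baseChange (AlgebraicClosure (v.adicCompletion ℚ))).IsIntegral
      (specVal v).integer := ⟨⟨M, rfl⟩⟩
  have hmemM : ((p • y : M.nonsingularReductionSubgroup hv0) :
      (M.baseChange (AlgebraicClosure (v.adicCompletion ℚ))).toAffine.Point) ∈
        kernel (specVal v) (M.baseChange (AlgebraicClosure (v.adicCompletion ℚ))) :=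
    (mem_kernel_iff_reducesToZero M _).mpr hred0
  -- transport the membership along `M ⊗ K̄_v = X ⊗ K̄_v`
  have key : ∀ (V : WeierstrassCurve (AlgebraicClosure (v.adicCompletion ℚ)))
      (hV : (W.localMinimalModel v).baseChange (AlgebraicClosure (v.adicCompletion ℚ)) = V)
      (Q : ((W.localMinimalModel v).baseChange
        (AlgebraicClosure (v.adicCompletion ℚ))).toAffine.Point)
      (hIV : V.IsIntegral (specVal v).integer),
      (haveI := hIV; Affine.Point.congrEquiv hV Q ∈ kernel (specVal v) V) →
        (haveI := hint; Q ∈ kernel (specVal v)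
          ((W.localMinimalModel v).baseChange (AlgebraicClosure (v.adicCompletion ℚ)))) := by
    intro V hV Q hIV h
    subst hV
    exact h
  have e : Affine.Point.congrEquiv hM ((p * c) • Φ R) =
      ((p • y : M.nonsingularReductionSubgroup hv0) :
        (M.baseChange (AlgebraicClosure (v.adicCompletion ℚ))).toAffine.Point) := by
    rw [hy, AddSubgroupClass.coe_nsmul, mul_smul, map_nsmul]
  have hmemM' : Affine.Point.congrEquiv hM ((p * c) • Φ R) ∈
      kernel (specVal v) (M.baseChange (AlgebraicClosure (v.adicCompletion ℚ))) := by
    rw [e]; exact @hmemM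
  have hK : (haveI := hint; ((p * c) • Φ R) ∈ kernel (specVal v)
      ((W.localMinimalModel v).baseChange (AlgebraicClosure (v.adicCompletion ℚ)))) :=
    key (M.baseChange (AlgebraicClosure (v.adicCompletion ℚ))) hM ((p * c) • Φ R) hIM hmemM'
  exact @hK

/-! ### §2 Level calculus for a fixed point of `E₁(X)`: `p • Q ∈ E₂ = {|z| ≤ |p|²}` -/

/-- **A `Γ_{ℚ_v}`-fixed `Q ∈ E₁(X)` has `p • Q ∈ E₁(X)` with `|z(p • Q)| ≤ |p|²`** (`X` any
`|·|_v`-integral equation over `ℚ_v`, `v ∋ p`): `z(Q)` is `Γ_{ℚ_v}`-invariant with `|z(Q)| < 1`, so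
`|z(Q)| ≤ |p|` (`p` a uniformizer; tree `spectralValuation_le_of_forall_inertia`), and
`|z(pQ) - p z(Q)| ≤ |z(Q)|²` (tree `val_zCoord_nsmul`). [cite: SilvermanAEC2009, Prop. VII.2.2] -/
theorem nsmul_mem_kernel_and_val_zCoord_le_sq (hpv : ((p : ℕ) : 𝓞 ℚ) ∈ v.asIdeal)
    {X : WeierstrassCurve (v.adicCompletion ℚ)}
    [hI : (X.baseChange (AlgebraicClosure (v.adicCompletion ℚ))).IsIntegral (specVal v).integer]
    {Q : (X.baseChange (AlgebraicClosure (v.adicCompletion ℚ))).toAffine.Point}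
    (hQ : Q ∈ kernel (specVal v) (X.baseChange (AlgebraicClosure (v.adicCompletion ℚ))))
    (hfix : ∀ σ : absoluteGaloisGroup (v.adicCompletion ℚ), Affine.Point.map
        ((absoluteGaloisGroup.toAlgEquiv _ σ :
          (AlgebraicClosure (v.adicCompletion ℚ)) ≃ₐ[v.adicCompletion ℚ] (AlgebraicClosure
              (v.adicCompletion ℚ))) : (AlgebraicClosure (v.adicCompletion ℚ)) →ₐ[v.adicCompletion
              ℚ] (AlgebraicClosure (v.adicCompletion ℚ))) Q = Q) :
    p • Q ∈ kernel (specVal v) (X.baseChange (AlgebraicClosure (v.adicCompletion ℚ))) ∧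
      specVal v (p • Q).zCoord ≤ specVal v (p : (AlgebraicClosure (v.adicCompletion ℚ))) ^ 2 := by
  have hw := specVal_spec v
  obtain ⟨𝔐, h𝔐⟩ := v.localPrimesAbove_nonempty
  have hϖ : Irreducible ((p : ℕ) : v.adicCompletionIntegers ℚ) :=
    irreducible_natCast_adicCompletionIntegers_rat hpv
  -- `z(Q)` is `Γ`-invariant
  have hx : ∀ σ ∈ 𝔐.inertia (absoluteGaloisGroup (v.adicCompletion ℚ)),
      absoluteGaloisGroup.toAlgEquiv (v.adicCompletion ℚ) σ Q.zCoord = Q.zCoord := by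
    intro σ _
    rcases Q with _ | ⟨x, y, h⟩
    · rw [WeierstrassCurve.Affine.Point.zCoord_zero', map_zero]
    · have hσ := hfix σ
      rw [Affine.Point.map_some] at hσ
      injection hσ with hx hy
      rw [WeierstrassCurve.Affine.Point.zCoord_some, map_div₀, map_neg]
      exact congrArg₂ (fun a b ↦ -a / b) hx hy
  have hzQ : specVal v Q.zCoord ≤ specVal v (p : (AlgebraicClosure (v.adicCompletion ℚ))) := by
    have h1 := spectralValuation_le_of_forall_inertia hw h𝔐 hϖ hx (val_zCoord_lt_one (w := specVal
        v) hQ)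
    rwa [SubringClass.coe_natCast, map_natCast] at h1
  obtain ⟨hpQ, -, hest⟩ := val_zCoord_nsmul (w := specVal v)
    (V := X.baseChange (AlgebraicClosure (v.adicCompletion ℚ))) p hQ
  refine ⟨hpQ, ?_⟩
  have e : (p • Q).zCoord = ((p • Q).zCoord - (p : (AlgebraicClosure (v.adicCompletion ℚ))) *
      Q.zCoord) +
      (p : (AlgebraicClosure (v.adicCompletion ℚ))) * Q.zCoord := by ring
  rw [e]
  refine (Valuation.map_add (specVal v) _ _).trans (max_le (hest.trans ?_) ?_)
  · rw [sq, sq]; exact mul_le_mul' hzQ hzQ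
  · rw [map_mul, sq]; exact mul_le_mul' le_rfl hzQ

/-- **No torsion on `E₂(X)`**: `Q ∈ E₁(X)` with `|z(Q)| < |p|` and `m • Q = 0`, `m > 0`, is `O`
(`|z(mQ)| = |m|·|z(Q)|`, tree `val_zCoord_nsmul_eq`). [cite: SilvermanAEC2009, Thm. IV.6.4(b), Prop. VII.2.2] -/
theorem eq_zero_of_nsmul_eq_zero_of_val_zCoord_lt (hpv : ((p : ℕ) : 𝓞 ℚ) ∈ v.asIdeal)
    {X : WeierstrassCurve (v.adicCompletion ℚ)}
    [hI : (X.baseChange (AlgebraicClosure (v.adicCompletion ℚ))).IsIntegral (specVal v).integer]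
    {Q : (X.baseChange (AlgebraicClosure (v.adicCompletion ℚ))).toAffine.Point}
    (hQ : Q ∈ kernel (specVal v) (X.baseChange (AlgebraicClosure (v.adicCompletion ℚ))))
    (hQp : specVal v Q.zCoord < specVal v (p : (AlgebraicClosure (v.adicCompletion ℚ))))
    {m : ℕ} (hm : 0 < m) (hmQ : m • Q = 0) : Q = 0 := by
  have hw := specVal_spec v
  haveI : CharZero (AlgebraicClosure (v.adicCompletion ℚ)) := charZero_of_injective_algebraMap
      (algebraMap ℚ _).injective
  have hunit : ∀ n : ℕ, ¬ p ∣ n → specVal v (n : (AlgebraicClosure (v.adicCompletion ℚ))) = 1 :=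
    fun n hn ↦ spectralValuation_natCast_eq_one_of_not_dvd hpv hw hn
  have h := val_zCoord_nsmul_eq (w := specVal v)
    (V := X.baseChange (AlgebraicClosure (v.adicCompletion ℚ))) hp.out hunit m hm.ne' hQ hQp
  rw [hmQ, WeierstrassCurve.Affine.Point.zCoord_zero, map_zero] at h
  have hm0 : specVal v (m : (AlgebraicClosure (v.adicCompletion ℚ))) ≠ 0 := (Valuation.ne_zero_iff
      _).mpr (Nat.cast_ne_zero.mpr hm.ne')
  have hz : specVal v Q.zCoord = 0 := by
    rcases mul_eq_zero.mp h.symm with h0 | h0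
    · exact absurd h0 hm0
    · exact h0
  exact (zCoord_eq_zero_iff (w := specVal v) hQ).mp ((Valuation.zero_iff _).mp hz)

omit [W.IsElliptic] in
/-- Transport of fixedness: for the equivariant `Φ` and a `Γ_{ℚ_v}`-fixed `R`, the point `Φ (N • R)`
is fixed by every `σ` acting through `Point.map`. [folklore] -/
theorem map_transport_nsmul_eq_of_fixed {X : WeierstrassCurve (v.adicCompletion ℚ)}
    (Φ : localPoints W (v.adicCompletion ℚ) ≃+ (X.baseChange (AlgebraicClosure (v.adicCompletion
        ℚ))).toAffine.Point)
    (hΦ : ∀ (σ : absoluteGaloisGroup (v.adicCompletion ℚ)) (Q : localPoints W (v.adicCompletion ℚ)),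
      Φ (σ • Q) = Affine.Point.map ((absoluteGaloisGroup.toAlgEquiv _ σ : (AlgebraicClosure
          (v.adicCompletion ℚ)) ≃ₐ[v.adicCompletion ℚ]
            (AlgebraicClosure (v.adicCompletion ℚ))) : (AlgebraicClosure (v.adicCompletion ℚ))
                →ₐ[v.adicCompletion ℚ] (AlgebraicClosure (v.adicCompletion ℚ))) (Φ Q))
    {R : localPoints W (v.adicCompletion ℚ)}
    (hR : ∀ σ : absoluteGaloisGroup (v.adicCompletion ℚ), σ • R = R) (N : ℕ)
    (σ : absoluteGaloisGroup (v.adicCompletion ℚ)) : Affine.Point.map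
        ((absoluteGaloisGroup.toAlgEquiv _ σ :
        (AlgebraicClosure (v.adicCompletion ℚ)) ≃ₐ[v.adicCompletion ℚ] (AlgebraicClosure
            (v.adicCompletion ℚ))) : (AlgebraicClosure (v.adicCompletion ℚ)) →ₐ[v.adicCompletion
            ℚ] (AlgebraicClosure (v.adicCompletion ℚ))) (Φ (N • R)) = Φ (N • R) := by
  rw [← hΦ σ (N • R), smul_comm σ N R, hR σ]

end Summit.BirchSwinnertonDyer.Rank1Residual.Additive.FixedLevel

end
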